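import Summits.QuantumFields.YangMills.Theorems.BalabanUVNodesN15TwoSpacingGluingNeumannKnitLetters
import HarnessLib

/-!
# THE GLUING STEP AT TWO LATTICE SPACINGS, LI: FILE 50's SOCKET CALLED FOR THE COVER's GLUED PAIR ON THE DOUBLED TORUS — `NE2PlusOperator` BY NAME ON THE REALISED FAMILY
# `knitInstance ∕ knitFamily`, `(gf i).M := L^m` LIVE, MODULO THE THREE ADJOINT-REMAINDER ROWS (dag-n15-c g13, FILE 93; N15 = NE2, s1 «background-layer OPERATOR ingredient»)

Cell `pub-ymgap`, seat `pub-ymgap-dag-n15-c` (R134 (a); HUMAN RULING D-0062), generation 13.  `bears_on: R4∕N15 · K3⁸ SpineGivenEndpointR13SepCoPHV (stmt-QuantumFields-27366)`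
(KEY MAP v2).  Filed `--supports stmt-QuantumFields-27366 --as helper` — COUNT-NEUTRAL.  Plumbing `def`s (the index `KnitIdx`; its torus `knitTor`, SIZED carrier `knitGeo`, bond lattices
`KnitX ∕ KnitX'`, blocks `knitBlk`, pairing `knitPr`; the realised instance `knitInstance` and kernel family `knitFamily`), the rest theorems; 0 `sorry`.  Imports BY NAME FILE 92
`…NeumannKnitLetters` (`gluedLetters_knit_of_rightRows`; through it FILES 80–91, the chain 45–79, dag-n15-a's PROGRAMME N, FILE 50's socket, n15-b's carriers); nothing in the tree
is modified.

WHAT.  §1 The index `i = (m, k, r, μ, ν)` (`k ≥ 1`, `4 ≤ L^k`): doubled torus `knitTor i = MP (paramsOf d L (m+1) k hL) = 2L·L^m`, SIZED [B6] carrier `knitGeo i = unitTorusGeoS L k · (L^m)`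
(the [B9] size parameter of the index IS `M = L^m`: `knitInstance_gf_M`, unbounded: `knitInstance_gf_M_unbounded`), bond lattices at spacings `L^{−k}`, `L^{−(k+r)}`, blocks `blkFine`,
King's pairing `kingPrV`; `knitInstance` = n15-b's `bgInstance` over this carrier (coefficient carriers `coeffBg`, (3.35) read blockwise, scale shift `r`); `knitFamily` = n15-b's
`opFamily` of FILE 50's `gluedOps` of the cover's parametrix pair `(parametrix h G, remainder Δ_a h G, remainderL Δ_a h G)` (FILE 70's `knitH`, `knitG`) at the two spacings with
`D = ∇_μ`, `D₃ = Δ`, `E = ∇*_ν`.  §2 ★★★ **`ne2PlusOperator_knit_of_rightRows`** — `d ≥ 1`, odd `L ≥ 3`, `a > 0`, any `c₃₅, θc, θ`: GIVEN the three adjoint-remainder rows (FILE 92's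
hypothesis), `NE2PlusOperator c₃₅ (knitInstance hL θc θ) (knitFamily hL a θc θ)` BY NAME — FILE 50 `ne2PlusOperator_glued_of_letters` fed with FILE 92's bundle, `θ_i = (L^k)^{−γ} =
rateWeight (knitGeo hL i) γ`, row-sum rate `σ = δ∕4` (`rowSum_unitTorusGeo`), `M₅′ = max M₅ 1`, `a₀ = 1`, the [B6] unit-torus facts `triangle254_unitTorusGeo`, `unitTorusGeo_len`,
`unitTorusGeo_dist_self`; ★ `ne2PlusOperator_knit_of_rightRows_dim4` (`d + 1 = 4`).

HONEST FRAMING ∕ LIMITS.  CONDITIONAL on the displayed adjoint-remainder rows (dag-n15-a N-IIn right rows `T±`; its `(c)⁺` is itself conditional on the located source-Hölder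
letter `hSrc`) — HYPOTHESES, not proved.  The family is the glued `U ≡ 1` family: the entry operators do not depend on the fine configuration `U`, so the (3.35) guard of the
coefficient carrier is consumed vacuously — this is NOT the background-dependent pair of [B9] (3.63)–(3.65); block-majorant bookkeeping over LANDED rows on the doubled-cube torus
MODEL (cube = half torus: circular as an estimate); nothing of [B6] (2.38)–(2.40) ∕ [B9] Thm 3.1, 3.14 asserted.  NE2⁺ NOT PRINTED for the physical family, NOT proved; N15 NOT
discharged; counts of record UNMOVED (typed 28∕28 · discharged 5∕27); one finite 𝕋⁴ at fixed ε per index — NOT infinite volume, NOT OS on ℝ⁴, NOT a mass gap, NOT Clay; R4 closes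
`BalabanLadder.UV` only.  Restate-immune (no Theses import).
-/

noncomputable section

namespace Summit.QuantumFields.YangMills.BalabanUVNodes.N15.Gluing

open Real
open Literature.MathematicalPhysics.QuantumFieldTheory.Balaban1983to89
open Literature.MathematicalPhysics.QuantumFieldTheory.Balaban1983to89.B5Prop11Plancherel (Tor fine)
open Literature.MathematicalPhysics.QuantumFieldTheory.Balaban1983to89.B11SectG (BlockNorm HasMaj RowSum)
open Literature.MathematicalPhysics.QuantumFieldTheory.Balaban1983to89.T4EtaRate (PairedInstance EtaPairing NE2PlusOperator)
open Literature.MathematicalPhysics.QuantumFieldTheory.Balaban1983to89.T4EtaRateDefect (idef rateWeight)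
open Literature.MathematicalPhysics.QuantumFieldTheory.Balaban1983to89.T4EtaRateCoeffDefect (pull)
open Literature.MathematicalPhysics.QuantumFieldTheory.Balaban1983to89.B6UnitTorusCarrier (unitTorusGeo triangle254_unitTorusGeo rowSum_unitTorusGeo unitTorusGeo_dist_self
  unitTorusGeo_len)
open Literature.MathematicalPhysics.QuantumFieldTheory.Balaban1983to89.B5SiteBridgeP12 (MP)
open Literature.MathematicalPhysics.QuantumFieldTheory.King1986.Torus (blockOf tdistT tdistT_nonneg)
open Summit.QuantumFields.YangMills.BalabanUVNodes.N15.VectorPiece (bshiftEquiv kingPrV blkFine unitTorusGeoS)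
open Summit.QuantumFields.YangMills.BalabanUVNodes.N15.BackgroundLayer (fgrad fgradAdj coeffBg fineGeo bgPairing bgInstance)
open Summit.QuantumFields.YangMills.BalabanUVNodes.N15.OperatorReadout (opGeo opFamily realisedInstance)
open Summit.QuantumFields.YangMills.BalabanUVNodes.N15.TwoGrid (paramsOf deltaOp)

/-! ## §1 The index and the realised family of the cover's glued pair -/

section Family

/-- THE INDEX of the cover's glued family: cube scale `m` (cubes of side `L·L^m` on the doubled torus `2L·L^m`; [B9] size parameter `M = L^m`), the coarse run's `k ≥ 1` scales with
`4 ≤ L^k`, the fine run's extra `r` scales, and the directions `μ`, `ν` of entries 1 and 2. [cite: Balaban1985BackgroundPropagators, Thm 3.1 p.397 («for M ≥ M₁»: the size parameter)] -/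
structure KnitIdx (d L : ℕ) : Type where
  /-- cube scale: side `L·L^m`, size parameter `M = L^m` -/
  m : ℕ
  /-- number of scales of the coarse run -/
  kk : ℕ
  /-- extra scales of the fine run -/
  r : ℕ
  /-- `k ≥ 1` -/
  one_le : 1 ≤ kk
  /-- `4 ≤ L^k` -/
  four_le : 4 ≤ L ^ kk
  /-- direction of entry 1 -/
  μ : Fin (d + 1)
  /-- direction of entry 2 -/
  ν : Fin (d + 1)

variable {d : ℕ} {L : ℕ} [NeZero L]

/-- The doubled torus `2L·L^m` of the index (dag-n15-a's `MP (paramsOf d L (m+1) k hL)`). [folklore] -/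
abbrev knitTor (hL : Odd L ∧ 1 < L) (i : KnitIdx d L) : Fin (d + 1) → ℕ := MP (paramsOf d L (i.m + 1) i.kk hL)

/-- THE SIZED [B6] CARRIER of the index: the unit-torus carrier with size parameter `M = L^m`. [cite: Balaban1985BackgroundPropagators, Thm 3.1 p.397 (the size parameter)] -/
abbrev knitGeo (hL : Odd L ∧ 1 < L) (i : KnitIdx d L) : B6.Geometry := unitTorusGeoS L i.kk (knitTor hL i) ((L : ℝ) ^ i.m)

/-- The coarse bond lattice (spacing `L^{−k}`). [folklore] -/
abbrev KnitX (hL : Odd L ∧ 1 < L) (i : KnitIdx d L) : Type := Tor (fine (L ^ i.kk) (knitTor hL i)) × Fin (d + 1)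

/-- The fine bond lattice (spacing `L^{−(k+r)}`). [folklore] -/
abbrev KnitX' (hL : Odd L ∧ 1 < L) (i : KnitIdx d L) : Type := Tor (fine (L ^ i.r * L ^ i.kk) (knitTor hL i)) × Fin (d + 1)

/-- The coarse block map (unit blocks). [folklore] -/
abbrev knitBlk (hL : Odd L ∧ 1 < L) (i : KnitIdx d L) : KnitX hL i → (knitGeo hL i).Site := blkFine L i.kk (knitTor hL i)

/-- King's pairing of fine bonds with coarse bonds. [cite: King1986, p.664 (convention before Prop. 3.8)] -/
abbrev knitPr (hL : Odd L ∧ 1 < L) (i : KnitIdx d L) : KnitX' hL i → KnitX hL i := kingPrV L i.kk i.r (knitTor hL i)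

/-- `L ≠ 0` on the carrier. [folklore] -/
theorem knitGeo_L_ne_zero (hL : Odd L ∧ 1 < L) (i : KnitIdx d L) : (knitGeo hL i).L ≠ 0 := Nat.cast_ne_zero.mpr (NeZero.ne L)

/-- THE REALISED PAIRED INSTANCE of the index: n15-b's `bgInstance` over the sized carrier (coefficient carriers `coeffBg` with the index's `M = L^m`, King's pairing, scale shift `r`).
[cite: Balaban1985BackgroundPropagators, Thm 3.14 pp.426–427 (typing template); (3.35) p.396] -/
def knitInstance (hL : Odd L ∧ 1 < L) (θc θ : ℝ) (i : KnitIdx d L) : PairedInstance :=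
  bgInstance (g := knitGeo hL i) (knitBlk hL i) (knitPr hL i) i.r (knitGeo_L_ne_zero hL i) θc θ

/-- **THE GUARD IS LIVE**: the fine realised instance's [B9] size parameter IS `L^m`. [folklore] -/
theorem knitInstance_gf_M (hL : Odd L ∧ 1 < L) (θc θ : ℝ) (i : KnitIdx d L) : (knitInstance hL θc θ i).gf.M = (L : ℝ) ^ i.m := rfl

/-- There is NO bounded-`M` witness on the family once one index exists at every `m` (given `k` with `4 ≤ L^k`): `L^m` is unbounded (`L ≥ 2`). [folklore] -/
theorem knitInstance_gf_M_unbounded (hL : Odd L ∧ 1 < L) (θc θ : ℝ) {kk : ℕ} (hk : 1 ≤ kk) (h4 : 4 ≤ L ^ kk) (M₅ : ℝ) :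
    ∃ i : KnitIdx d L, M₅ ≤ (knitInstance hL θc θ i).gf.M := by
  obtain ⟨m, hm⟩ := pow_unbounded_of_one_lt M₅ (by exact_mod_cast hL.2 : (1 : ℝ) < (L : ℝ))
  exact ⟨⟨m, kk, 0, hk, h4, 0, 0⟩, hm.le⟩

/-- THE KERNEL FAMILY of the index: FILE 50's `gluedOps` of the cover's parametrix pair at the two spacings — `G₀ = Σ_k M_{h_k}G(□_k)M_{h_k}`, `R = −Σ_k[Δ_a, M_{h_k}]G(□_k)M_{h_k}`, `R̃` its
adjoint arrangement, `D = ∇_μ`, `D₃ = Δ`, `E = ∇*_ν` — read through n15-b's `opFamily`; the entries do not depend on the fine configuration (glued `U ≡ 1` family).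
[cite: Balaban1984PropagatorsII, (2.133)–(2.136) p.247 (shapes); Balaban1985BackgroundPropagators, (3.42) p.397 (the four entries: shape)] -/
def knitFamily (hL : Odd L ∧ 1 < L) (a θc θ : ℝ) (i : KnitIdx d L) : B9.KernelFamily (knitInstance hL θc θ i).gc (knitInstance hL θc θ i).Bf :=
  opFamily (knitBlk hL i) (knitBlk hL i ∘ knitPr hL i) (fun k _ =>
    gluedOps (knitPr hL i)
      (parametrix (knitH d L i.m i.kk (L ^ i.kk) hL) (knitG d L i.m i.kk (L ^ i.kk) hL a))
      (remainder (deltaOp (knitTor hL i) (L ^ i.kk) a) (knitH d L i.m i.kk (L ^ i.kk) hL) (knitG d L i.m i.kk (L ^ i.kk) hL a))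
      (remainderL (deltaOp (knitTor hL i) (L ^ i.kk) a) (knitH d L i.m i.kk (L ^ i.kk) hL) (knitG d L i.m i.kk (L ^ i.kk) hL a))
      (fgrad ((L ^ i.kk : ℕ) : ℝ) (bshiftEquiv (knitTor hL i) (L ^ i.kk) i.μ))
      (lapOp ((L ^ i.kk : ℕ) : ℝ) (bshiftEquiv (knitTor hL i) (L ^ i.kk)) 0)
      (fgradAdj ((L ^ i.kk : ℕ) : ℝ) (bshiftEquiv (knitTor hL i) (L ^ i.kk) i.ν))
      (parametrix (knitH d L i.m i.kk (L ^ i.r * L ^ i.kk) hL) (knitG d L i.m i.kk (L ^ i.r * L ^ i.kk) hL a))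
      (remainder (deltaOp (knitTor hL i) (L ^ i.r * L ^ i.kk) a) (knitH d L i.m i.kk (L ^ i.r * L ^ i.kk) hL) (knitG d L i.m i.kk (L ^ i.r * L ^ i.kk) hL a))
      (remainderL (deltaOp (knitTor hL i) (L ^ i.r * L ^ i.kk) a) (knitH d L i.m i.kk (L ^ i.r * L ^ i.kk) hL) (knitG d L i.m i.kk (L ^ i.r * L ^ i.kk) hL a))
      (fgrad ((L ^ i.r * L ^ i.kk : ℕ) : ℝ) (bshiftEquiv (knitTor hL i) (L ^ i.r * L ^ i.kk) i.μ))
      (lapOp ((L ^ i.r * L ^ i.kk : ℕ) : ℝ) (bshiftEquiv (knitTor hL i) (L ^ i.r * L ^ i.kk)) 0)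
      (fgradAdj ((L ^ i.r * L ^ i.kk : ℕ) : ℝ) (bshiftEquiv (knitTor hL i) (L ^ i.r * L ^ i.kk) i.ν)) k)

end Family

/-! ## §2 The socket call, modulo the adjoint-remainder rows -/

section Node

variable {d : ℕ} {L : ℕ} [NeZero L]

/-- ★★★ **NE2⁺, OPERATOR LAYER, BY NAME, FOR THE COVER's GLUED PAIR ON THE DOUBLED TORUS — `(gf i).M := L^m` LIVE — MODULO THE THREE ADJOINT-REMAINDER ROWS.**  `d ≥ 1`, odd `L ≥ 3`,
`a > 0`, any `c₃₅, θc, θ`.  Under the hypothesis of `gluedLetters_knit_of_rightRows`: `NE2PlusOperator c₃₅ (knitInstance hL θc θ) (knitFamily hL a θc θ)` — FILE 50's socket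
`ne2PlusOperator_glued_of_letters` fed with the bundle, `θ_i = (L^k)^{−γ} = rateWeight (knitGeo hL i) γ ·`, row-sum rate `σ = δ∕4` (`rowSum_unitTorusGeo`), `M₅′ = max M₅ 1`, `a₀ = 1` (the
entries do not depend on `U`: the glued `U ≡ 1` family).  [cite: Balaban1985BackgroundPropagators, Thm 3.1 p.397 (quantifier template «M ≥ M₁ … Mα₀ ≤ a₀»), p.399 (architecture);
Balaban1984PropagatorsII, Prop. 2.6 (2.135)–(2.136) p.247 (mechanism); King1986, Prop. 3.9 (3.73) p.665 (rate factor)] -/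
theorem ne2PlusOperator_knit_of_rightRows (hd1 : 1 ≤ d) (hL : Odd L ∧ 1 < L) {a : ℝ} (ha : 0 < a) (c35 θc θ : ℝ) {M₅ : ℝ}
    (hRL : ∃ δL κL rL γL : ℝ, 0 < δL ∧ 0 ≤ κL ∧ 0 ≤ rL ∧ 0 < γL ∧ ∀ (m kk r : ℕ) (_hk : 1 ≤ kk) (_hn4 : 4 ≤ L ^ kk) (_hM : M₅ ≤ (L : ℝ) ^ m),
      HasMaj (BlockNorm.ofBlocks (unitTorusGeo L kk (MP (paramsOf d L (m + 1) kk hL)))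
          (fun b : Tor (fine (L ^ kk) (MP (paramsOf d L (m + 1) kk hL))) × Fin (d + 1) => blockOf (L ^ kk) (MP (paramsOf d L (m + 1) kk hL)) b.1))
        (BlockNorm.ofBlocks (unitTorusGeo L kk (MP (paramsOf d L (m + 1) kk hL)))
          (fun b : Tor (fine (L ^ kk) (MP (paramsOf d L (m + 1) kk hL))) × Fin (d + 1) => blockOf (L ^ kk) (MP (paramsOf d L (m + 1) kk hL)) b.1))
        (remainderL (deltaOp (MP (paramsOf d L (m + 1) kk hL)) (L ^ kk) a) (knitH d L m kk (L ^ kk) hL) (knitG d L m kk (L ^ kk) hL a))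
        (fun y y' => κL / (L : ℝ) ^ m * Real.exp (-(δL * tdistT (MP (paramsOf d L (m + 1) kk hL)) y y'))) ∧
      HasMaj (BlockNorm.ofBlocks (unitTorusGeo L kk (MP (paramsOf d L (m + 1) kk hL)))
          (fun x : Tor (fine (L ^ r * L ^ kk) (MP (paramsOf d L (m + 1) kk hL))) × Fin (d + 1) => blockOf (L ^ r * L ^ kk) (MP (paramsOf d L (m + 1) kk hL)) x.1))
        (BlockNorm.ofBlocks (unitTorusGeo L kk (MP (paramsOf d L (m + 1) kk hL)))
          (fun x : Tor (fine (L ^ r * L ^ kk) (MP (paramsOf d L (m + 1) kk hL))) × Fin (d + 1) => blockOf (L ^ r * L ^ kk) (MP (paramsOf d L (m + 1) kk hL)) x.1))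
        (remainderL (deltaOp (MP (paramsOf d L (m + 1) kk hL)) (L ^ r * L ^ kk) a) (knitH d L m kk (L ^ r * L ^ kk) hL) (knitG d L m kk (L ^ r * L ^ kk) hL a))
        (fun y y' => κL / (L : ℝ) ^ m * Real.exp (-(δL * tdistT (MP (paramsOf d L (m + 1) kk hL)) y y'))) ∧
      HasMaj (BlockNorm.ofBlocks (unitTorusGeo L kk (MP (paramsOf d L (m + 1) kk hL)))
          (fun b : Tor (fine (L ^ kk) (MP (paramsOf d L (m + 1) kk hL))) × Fin (d + 1) => blockOf (L ^ kk) (MP (paramsOf d L (m + 1) kk hL)) b.1))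
        (BlockNorm.ofBlocks (unitTorusGeo L kk (MP (paramsOf d L (m + 1) kk hL)))
          (fun x : Tor (fine (L ^ r * L ^ kk) (MP (paramsOf d L (m + 1) kk hL))) × Fin (d + 1) => blockOf (L ^ r * L ^ kk) (MP (paramsOf d L (m + 1) kk hL)) x.1))
        (idef (pull (kingPrV L kk r (MP (paramsOf d L (m + 1) kk hL)))) (pull (kingPrV L kk r (MP (paramsOf d L (m + 1) kk hL))))
          (remainderL (deltaOp (MP (paramsOf d L (m + 1) kk hL)) (L ^ r * L ^ kk) a) (knitH d L m kk (L ^ r * L ^ kk) hL) (knitG d L m kk (L ^ r * L ^ kk) hL a))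
          (remainderL (deltaOp (MP (paramsOf d L (m + 1) kk hL)) (L ^ kk) a) (knitH d L m kk (L ^ kk) hL) (knitG d L m kk (L ^ kk) hL a)))
        (fun y y' => rL * ((L : ℝ) ^ kk) ^ (-γL) * Real.exp (-(δL * tdistT (MP (paramsOf d L (m + 1) kk hL)) y y')))) :
    NE2PlusOperator c35 (knitInstance (d := d) hL θc θ) (knitFamily (d := d) hL a θc θ) := by
  obtain ⟨δ, A, κ₀, m₀, r₀, γ, hδ, hA, hκ₀, hm₀, hr₀, hγ, H⟩ := gluedLetters_knit_of_rightRows (d := d) hd1 hL ha hRL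
  have hL0 : L ≠ 0 := by have := hL.2; omega
  have hLr : (0 : ℝ) < (L : ℝ) := by exact_mod_cast Nat.pos_of_ne_zero hL0
  have hσ : 0 < δ / 4 := by positivity
  exact ne2PlusOperator_glued_of_letters (fun i => knitGeo hL i) (KnitX hL) (KnitX' hL) (knitBlk hL) (knitPr hL)
    (fun i => fineGeo (knitGeo hL i) (KnitX' hL i) (knitBlk hL i ∘ knitPr hL i) i.r)
    (fun i => coeffBg (fun x : KnitX hL i => x) (knitGeo hL i).M θc) (fun i => coeffBg (knitPr hL i) (knitGeo hL i).M θ)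
    (fun i => bgPairing (knitBlk hL i) (knitPr hL i) i.r (knitGeo_L_ne_zero hL i) θc θ)
    (fun i _ => parametrix (knitH d L i.m i.kk (L ^ i.kk) hL) (knitG d L i.m i.kk (L ^ i.kk) hL a))
    (fun i _ => remainder (deltaOp (knitTor hL i) (L ^ i.kk) a) (knitH d L i.m i.kk (L ^ i.kk) hL) (knitG d L i.m i.kk (L ^ i.kk) hL a))
    (fun i _ => remainderL (deltaOp (knitTor hL i) (L ^ i.kk) a) (knitH d L i.m i.kk (L ^ i.kk) hL) (knitG d L i.m i.kk (L ^ i.kk) hL a))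
    (fun i _ => fgrad ((L ^ i.kk : ℕ) : ℝ) (bshiftEquiv (knitTor hL i) (L ^ i.kk) i.μ))
    (fun i _ => lapOp ((L ^ i.kk : ℕ) : ℝ) (bshiftEquiv (knitTor hL i) (L ^ i.kk)) 0)
    (fun i _ => fgradAdj ((L ^ i.kk : ℕ) : ℝ) (bshiftEquiv (knitTor hL i) (L ^ i.kk) i.ν))
    (fun i _ => parametrix (knitH d L i.m i.kk (L ^ i.r * L ^ i.kk) hL) (knitG d L i.m i.kk (L ^ i.r * L ^ i.kk) hL a))
    (fun i _ => remainder (deltaOp (knitTor hL i) (L ^ i.r * L ^ i.kk) a) (knitH d L i.m i.kk (L ^ i.r * L ^ i.kk) hL) (knitG d L i.m i.kk (L ^ i.r * L ^ i.kk) hL a))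
    (fun i _ => remainderL (deltaOp (knitTor hL i) (L ^ i.r * L ^ i.kk) a) (knitH d L i.m i.kk (L ^ i.r * L ^ i.kk) hL) (knitG d L i.m i.kk (L ^ i.r * L ^ i.kk) hL a))
    (fun i _ => fgrad ((L ^ i.r * L ^ i.kk : ℕ) : ℝ) (bshiftEquiv (knitTor hL i) (L ^ i.r * L ^ i.kk) i.μ))
    (fun i _ => lapOp ((L ^ i.r * L ^ i.kk : ℕ) : ℝ) (bshiftEquiv (knitTor hL i) (L ^ i.r * L ^ i.kk)) 0)
    (fun i _ => fgradAdj ((L ^ i.r * L ^ i.kk : ℕ) : ℝ) (bshiftEquiv (knitTor hL i) (L ^ i.r * L ^ i.kk) i.ν))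
    c35 (fun i => triangle254_unitTorusGeo L i.kk (knitTor hL i)) (fun i y y' => tdistT_nonneg _ _ _) (fun i y => unitTorusGeo_dist_self L i.kk (knitTor hL i) y)
    (fun i => rowSum_unitTorusGeo L i.kk (knitTor hL i) hσ) hσ.le (B4Sect5Proof.latticeConst_nonneg (d + 1) hσ.le)
    (fun i => inv_pos.mpr (pow_pos hLr _)) (fun i => hLr) (fun i y => (unitTorusGeo_len L i.kk (knitTor hL i) hL0 y).symm.le)
    ⟨max M₅ 1, δ, 1, A, κ₀, m₀, r₀, γ, fun i => ((L : ℝ) ^ i.kk) ^ (-γ), lt_max_of_lt_right one_pos, by linarith, one_pos, hA, hκ₀, hm₀, hr₀, hγ,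
      fun i => Real.rpow_nonneg (pow_nonneg hLr.le _) _, fun i y => le_rfl,
      fun i hM α₀ _ _ U _ => H i.m i.kk i.r i.one_le i.four_le i.μ i.ν ((le_max_left _ _).trans hM)⟩

/-- The four-dimensional instance (`d + 1 = 4`). [cite: Balaban1985BackgroundPropagators, Thm 3.1 p.397 (quantifier template)] -/
theorem ne2PlusOperator_knit_of_rightRows_dim4 {L : ℕ} [NeZero L] (hL : Odd L ∧ 1 < L) {a : ℝ} (ha : 0 < a) (c35 θc θ : ℝ) {M₅ : ℝ}
    (hRL : ∃ δL κL rL γL : ℝ, 0 < δL ∧ 0 ≤ κL ∧ 0 ≤ rL ∧ 0 < γL ∧ ∀ (m kk r : ℕ) (_hk : 1 ≤ kk) (_hn4 : 4 ≤ L ^ kk) (_hM : M₅ ≤ (L : ℝ) ^ m),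
      HasMaj (BlockNorm.ofBlocks (unitTorusGeo L kk (MP (paramsOf 3 L (m + 1) kk hL)))
          (fun b : Tor (fine (L ^ kk) (MP (paramsOf 3 L (m + 1) kk hL))) × Fin (3 + 1) => blockOf (L ^ kk) (MP (paramsOf 3 L (m + 1) kk hL)) b.1))
        (BlockNorm.ofBlocks (unitTorusGeo L kk (MP (paramsOf 3 L (m + 1) kk hL)))
          (fun b : Tor (fine (L ^ kk) (MP (paramsOf 3 L (m + 1) kk hL))) × Fin (3 + 1) => blockOf (L ^ kk) (MP (paramsOf 3 L (m + 1) kk hL)) b.1))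
        (remainderL (deltaOp (MP (paramsOf 3 L (m + 1) kk hL)) (L ^ kk) a) (knitH 3 L m kk (L ^ kk) hL) (knitG 3 L m kk (L ^ kk) hL a))
        (fun y y' => κL / (L : ℝ) ^ m * Real.exp (-(δL * tdistT (MP (paramsOf 3 L (m + 1) kk hL)) y y'))) ∧
      HasMaj (BlockNorm.ofBlocks (unitTorusGeo L kk (MP (paramsOf 3 L (m + 1) kk hL)))
          (fun x : Tor (fine (L ^ r * L ^ kk) (MP (paramsOf 3 L (m + 1) kk hL))) × Fin (3 + 1) => blockOf (L ^ r * L ^ kk) (MP (paramsOf 3 L (m + 1) kk hL)) x.1))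
        (BlockNorm.ofBlocks (unitTorusGeo L kk (MP (paramsOf 3 L (m + 1) kk hL)))
          (fun x : Tor (fine (L ^ r * L ^ kk) (MP (paramsOf 3 L (m + 1) kk hL))) × Fin (3 + 1) => blockOf (L ^ r * L ^ kk) (MP (paramsOf 3 L (m + 1) kk hL)) x.1))
        (remainderL (deltaOp (MP (paramsOf 3 L (m + 1) kk hL)) (L ^ r * L ^ kk) a) (knitH 3 L m kk (L ^ r * L ^ kk) hL) (knitG 3 L m kk (L ^ r * L ^ kk) hL a))
        (fun y y' => κL / (L : ℝ) ^ m * Real.exp (-(δL * tdistT (MP (paramsOf 3 L (m + 1) kk hL)) y y'))) ∧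
      HasMaj (BlockNorm.ofBlocks (unitTorusGeo L kk (MP (paramsOf 3 L (m + 1) kk hL)))
          (fun b : Tor (fine (L ^ kk) (MP (paramsOf 3 L (m + 1) kk hL))) × Fin (3 + 1) => blockOf (L ^ kk) (MP (paramsOf 3 L (m + 1) kk hL)) b.1))
        (BlockNorm.ofBlocks (unitTorusGeo L kk (MP (paramsOf 3 L (m + 1) kk hL)))
          (fun x : Tor (fine (L ^ r * L ^ kk) (MP (paramsOf 3 L (m + 1) kk hL))) × Fin (3 + 1) => blockOf (L ^ r * L ^ kk) (MP (paramsOf 3 L (m + 1) kk hL)) x.1))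
        (idef (pull (kingPrV L kk r (MP (paramsOf 3 L (m + 1) kk hL)))) (pull (kingPrV L kk r (MP (paramsOf 3 L (m + 1) kk hL))))
          (remainderL (deltaOp (MP (paramsOf 3 L (m + 1) kk hL)) (L ^ r * L ^ kk) a) (knitH 3 L m kk (L ^ r * L ^ kk) hL) (knitG 3 L m kk (L ^ r * L ^ kk) hL a))
          (remainderL (deltaOp (MP (paramsOf 3 L (m + 1) kk hL)) (L ^ kk) a) (knitH 3 L m kk (L ^ kk) hL) (knitG 3 L m kk (L ^ kk) hL a)))
        (fun y y' => rL * ((L : ℝ) ^ kk) ^ (-γL) * Real.exp (-(δL * tdistT (MP (paramsOf 3 L (m + 1) kk hL)) y y')))) :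
    NE2PlusOperator c35 (knitInstance (d := 3) hL θc θ) (knitFamily (d := 3) hL a θc θ) :=
  ne2PlusOperator_knit_of_rightRows (d := 3) (by norm_num) hL ha c35 θc θ hRL

end Node

end Summit.QuantumFields.YangMills.BalabanUVNodes.N15.Gluing

end
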